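import Literature.MathematicalPhysics.QuantumFieldTheory.Balaban1983to89.B15Prop1DatumCoordinates
import Literature.MathematicalPhysics.QuantumFieldTheory.Balaban1983to89.B15AveragingHolomorphicLocalAnalytic
import Literature.MathematicalPhysics.QuantumFieldTheory.Balaban1983to89.B15AveragingHolomorphicTowerRegion

/-!
# `Balaban1983to89.B15Prop1DatumCoordinatesTower` — [Balaban1988Convergent] = «[III]», (2.10)–(2.12) p. 256; [Balaban1985Variational] = «[15]», Sect. C (47)–(48) p. 285, Sect. G p. 305,
# p. 307, Prop. 9 (190) p. 309; [Balaban1987RG1] (0.4) p. 253, (0.21) p. 256; [Balaban1985Averaging] (21) p. 21: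
# THE HOLOMORPHIC LOGARITHMIC DATUM COORDINATES UNDER THE PER-TOWER (0.4) GUARD ONLY — the «TP» twin of `B15Prop1DatumCoordinates` (LOCATED-E1-HSB repair step (r3), link 1∕9)

Honest framing: statement-level skeleton of published theorems with citation tags; proofs where landed; nothing here is a claim about the
Yang–Mills mass gap.  Cell `pub-ymgap`, HUMAN RULING D-0062 (Track A), seat `pub-ymgap-dag-n12-c` g24 (lane owner N12 = [B15], strategy s1; lane memo `N12-UNIFORMITY-SPEC.md` §6,
plan g91 word pub-ymgap INBOX l.45435 «(r3) = ADDITIVE TP-twins»); count-neutral; N12 NOT discharged; finite 𝕋⁴ at fixed ε; nothing continuum ∕ OS ∕ mass-gap ∕ Clay.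

WHY.  `B15Prop1DatumCoordinates` (dag-n12-w1 g2) proves the six facts about the datum coordinates `κ Q i = logCoordC (W_{j_i}(c_i)⋆ · iterMh j_i Q c_i)` that the local minimiser chart
(`B15Prop1LocalChartAtBaseField` → … → the (J0′) producer `hMin_atRecord_of_node00Letters_thm1AtBase_central`) consumes — zero on the fibre, analytic near the base, real on `SU(2)` data,
`θ`-equivariant, injective — from the GLOBAL guards `SmallBelow k U₀` ∕ `SmallBelow k Q₀` ((0.4) small at EVERY coarse bond of the torus below `k`).  Those are false for data rough off `Z`
(lane memo §6 «LOCATED-E1-HSB»).  But `κ` reads the holomorphic iterate AT THE CONSTRAINED BONDS ONLY, and steps (r1)∕(r2) (`B15AveragingHolomorphicLocal` ∕ `…LocalAnalytic` ∕ `…TowerRegion`)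
give every needed fact from the guard ALONG THE TOWER `blockIter j ⁻¹' {c₋, c₊}` of each constrained bond `(j, c)`.  THIS MODULE re-proves the six facts VERBATIM with `hsb·` replaced by the
per-tower guards `hg·` (enumerated over `Node00.constrEnum 𝔹 k`, the index of `κ`) and the standing range `k ≤ m + K`; the tower guards are INHABITED for a (2.12)-class configuration and for
the pull-back datum by `Summits/…/BalabanUVNodesN12TowerGuardsOfClass` (step (r2)).  The old module is untouched and keeps serving the small-field readings.

CONTENTS (theorems only; no `def`, no `instance`, no `sorry`).  §1 `star_coe_mul_iterMh_coeField_of_guardOn` (at one tower-guarded bond the relative holomorphic average is `W⋆·Ū`) ·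
`polydiscOn_constr_of_guardOn` · `eventually_polydiscOn_one_constr` · ★ `eventually_guardOn_constr` (the tower guards at all constrained bonds are OPEN among `SU(N)` fields — twin of
`eventually_smallBelow`).  §2 `eventually_norm_rel_sub_one_lt_of_guardOn` · ★ `datumCoord_coeField_eq_zero_of_agreeOn_of_guardOn` · ★★ `eventually_analyticAt_datumCoord_of_guardOn` ∕
`eventually_differentiableAt_datumCoord_of_guardOn` · ★★ `eventually_datumCoord_real_of_guardOn` · ★★ `eventually_datumCoord_theta_of_guardOn`.  §3 ★★ `agreeOn_of_datumCoord_eq_of_guardOn` ·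
★ `eventually_agreeOn_of_datumCoord_eq_of_guardOn`.
HONEST SCOPE: the same calculus as the twin, re-keyed; nothing of Bałaban's estimates; N12 NOT discharged; the YM mass gap (Clay) is NOT proved by any of this — R4 closes only the conditional
finite-𝕋⁴ rung `BalabanLadder.UV`.
-/

noncomputable section

namespace Literature.MathematicalPhysics.QuantumFieldTheory.Balaban1983to89.B15Prop1DatumCoordinatesTower

open Set Filter
open scoped Topology ComplexConjugate
open Literature.MathematicalPhysics.QuantumFieldTheory.Balaban1983to89.Node00 (SU coeField coeField_apply SmallBelow ConstrSet constrCard constrEnum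
  coe_loopHol norm_loopM_coeField_sub_one_lt star_coe_mul_coe_SU coe_mul_star_coe_SU)
open B15AveragingHolomorphic (holMh loopMh iterMh loopMh_coeField)
open B15AveragingAnalytic (analyticAt_holMh analyticAt_logCoordC)
open B15AveragingHolomorphicLocalAnalytic (analyticAt_iterMh_apply_of_polydiscOn eventually_polydiscOn polydiscOn_of_guardOn eventually_guardOn eventually_polydiscOn_one
  iterMh_theta_apply_of_polydiscOn)
open B15AveragingHolomorphicTowerRegion (preimage_blockIter_saturated self_mem_bondsIn_towerRegion iterMh_coeField_apply_eq_of_guardOn_towerRegion)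
open B15SU2ChartHolomorphic (genE expPointC expMulC logCoordC logCoordC_apply expPointC_logCoordC logCoordC_theta)
open B15Prop1DatumCoordinates (logCoordC_one star_inv_relMatrix det_relMatrix deltaSU_le_one)
open ExpMeanLog (expMeanLogSU deltaSU lt_third_of_lt_deltaSU)
open MatrixLog (mlog mlog_one)
open BlockAveraging (Small Idx blockAvg)
open B10Eq42TorusConstraint (bondsIn mem_bondsIn_iff)
open B14.Eq22Determines (blockIter)
open T4CubeChartGnomonic (SU2)
open T4Continuum B15DeterminingSets GaugeField
open scoped Matrix.Norms.L2Operator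

/-! ## §1  One tower-guarded constrained bond; the tower guards at all constrained bonds are open -/

section Guard

variable {P : Params} {N : ℕ} [NeZero N]

/-- **AT A TOWER-GUARDED BOND THE RELATIVE HOLOMORPHIC AVERAGE IS THE `SU(N)` MATRIX `W_j(c)⋆ · ↑(Ū^j(U)(c))`** (step (r1) at the tower region; the twin of
`B15Prop1DatumCoordinates.star_coe_mul_iterMh_coeField`, which asks the global `SmallBelow`). [cite: Balaban1987RG1, (0.21) p.256; Balaban1988Convergent, (2.11) p.256] -/
theorem star_coe_mul_iterMh_coeField_of_guardOn (W : MSField P (SU N)) {U : GaugeField P 0 (SU N)} {j : ℕ} (hj : j ≤ P.m + P.K) (c : PBond P j)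
    (hg : ∀ j', j' < j → ∀ c' : PBond P (j' + 1), c' ∈ bondsIn (j' + 1) (blockIter j ⁻¹' ({c.src, c.tgt} : Set (Site P j))) →
      Small expMeanLogSU (Averaging.iter (fun j => blockAvg (P := P) (j := j) expMeanLogSU) j' U) c') :
    star ((W j c : SU N) : Matrix (Fin N) (Fin N) ℂ) * iterMh j (coeField U) c =
      star ((W j c : SU N) : Matrix (Fin N) (Fin N) ℂ) *
        ((avgFamily (fun j => blockAvg (P := P) (j := j) expMeanLogSU) U j c : SU N) : Matrix (Fin N) (Fin N) ℂ) := by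
  rw [iterMh_coeField_apply_eq_of_guardOn_towerRegion hj c hg]
  rfl

/-- The tower matrix inequalities `‖loop − 1‖ < δ_N` at a tower-guarded bond, at any matrix field matching `↑U` on the tower's fine bonds (`…LocalAnalytic.polydiscOn_of_guardOn` at the tower
region). [cite: Balaban1987RG1, (0.4) p.253 (bookkeeping)] -/
theorem polydiscOn_constr_of_guardOn {U : GaugeField P 0 (SU N)} {j : ℕ} (hj : j ≤ P.m + P.K) (c : PBond P j)
    (hg : ∀ j', j' < j → ∀ c' : PBond P (j' + 1), c' ∈ bondsIn (j' + 1) (blockIter j ⁻¹' ({c.src, c.tgt} : Set (Site P j))) →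
      Small expMeanLogSU (Averaging.iter (fun j => blockAvg (P := P) (j := j) expMeanLogSU) j' U) c')
    {V₀ : PBond P 0 → Matrix (Fin N) (Fin N) ℂ} (hV₀ : ∀ b : PBond P 0, b ∈ bondsIn 0 (blockIter j ⁻¹' ({c.src, c.tgt} : Set (Site P j))) → V₀ b = coeField U b) :
    ∀ j', j' < j → ∀ c' : PBond P (j' + 1), c' ∈ bondsIn (j' + 1) (blockIter j ⁻¹' ({c.src, c.tgt} : Set (Site P j))) →
      ∀ i : Idx P, ‖loopMh (iterMh j' V₀) c' i - 1‖ < deltaSU (Fin N) :=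
  polydiscOn_of_guardOn j hj (preimage_blockIter_saturated hj _) hg hV₀

/-- Near the matrix field of a tower-guarded `SU(N)` field, the tower polydisc `‖loop − 1‖ < 1` below `j` holds (so the iterate at `c` is analytic there). [cite: Balaban1987RG1, (0.4) p.253 (bookkeeping)] -/
theorem eventually_polydiscOn_one_constr {U : GaugeField P 0 (SU N)} {j : ℕ} (hj : j ≤ P.m + P.K) (c : PBond P j)
    (hg : ∀ j', j' < j → ∀ c' : PBond P (j' + 1), c' ∈ bondsIn (j' + 1) (blockIter j ⁻¹' ({c.src, c.tgt} : Set (Site P j))) →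
      Small expMeanLogSU (Averaging.iter (fun j => blockAvg (P := P) (j := j) expMeanLogSU) j' U) c') :
    ∀ᶠ Q in 𝓝 (coeField U), ∀ j', j' < j → ∀ c' : PBond P (j' + 1), c' ∈ bondsIn (j' + 1) (blockIter j ⁻¹' ({c.src, c.tgt} : Set (Site P j))) →
      ∀ i : Idx P, ‖loopMh (iterMh j' Q) c' i - 1‖ < 1 :=
  eventually_polydiscOn_one j hj (preimage_blockIter_saturated hj _) hg

variable (𝔹 : DetSet P) (k : ℕ)

/-- ★ **THE TOWER GUARDS AT ALL CONSTRAINED BONDS ARE OPEN** (the twin of `B15Prop1DatumCoordinates.eventually_smallBelow`): near the matrix field of an `SU(N)` configuration guarded along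
the tower of every constrained bond of `𝔹` of level `≤ k`, every `SU(N)` configuration is so guarded (finitely many bonds; `…LocalAnalytic.eventually_guardOn` at each tower region).
[cite: Balaban1987RG1, (0.4) p.253, (0.21) p.256; Balaban1988Convergent, (2.2) p.255] -/
theorem eventually_guardOn_constr (hk : k ≤ P.m + P.K) {U₀ : GaugeField P 0 (SU N)}
    (hg : ∀ i : Fin (constrCard 𝔹 k), ∀ j', j' < (((constrEnum 𝔹 k).symm i).1 : ℕ) → ∀ c' : PBond P (j' + 1),
      c' ∈ bondsIn (j' + 1) (blockIter (((constrEnum 𝔹 k).symm i).1 : ℕ) ⁻¹'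
        ({((constrEnum 𝔹 k).symm i).2.1.src, ((constrEnum 𝔹 k).symm i).2.1.tgt} : Set (Site P ((constrEnum 𝔹 k).symm i).1))) →
        Small expMeanLogSU (Averaging.iter (fun j => blockAvg (P := P) (j := j) expMeanLogSU) j' U₀) c') :
    ∀ᶠ Q in 𝓝 (coeField U₀), ∀ U : GaugeField P 0 (SU N), coeField U = Q →
      ∀ i : Fin (constrCard 𝔹 k), ∀ j', j' < (((constrEnum 𝔹 k).symm i).1 : ℕ) → ∀ c' : PBond P (j' + 1),
        c' ∈ bondsIn (j' + 1) (blockIter (((constrEnum 𝔹 k).symm i).1 : ℕ) ⁻¹'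
          ({((constrEnum 𝔹 k).symm i).2.1.src, ((constrEnum 𝔹 k).symm i).2.1.tgt} : Set (Site P ((constrEnum 𝔹 k).symm i).1))) →
          Small expMeanLogSU (Averaging.iter (fun j => blockAvg (P := P) (j := j) expMeanLogSU) j' U) c' := by
  have key : ∀ i : Fin (constrCard 𝔹 k), ∀ᶠ Q in 𝓝 (coeField U₀), ∀ U : GaugeField P 0 (SU N), coeField U = Q →
      ∀ j', j' < (((constrEnum 𝔹 k).symm i).1 : ℕ) → ∀ c' : PBond P (j' + 1),
        c' ∈ bondsIn (j' + 1) (blockIter (((constrEnum 𝔹 k).symm i).1 : ℕ) ⁻¹'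
          ({((constrEnum 𝔹 k).symm i).2.1.src, ((constrEnum 𝔹 k).symm i).2.1.tgt} : Set (Site P ((constrEnum 𝔹 k).symm i).1))) →
          Small expMeanLogSU (Averaging.iter (fun j => blockAvg (P := P) (j := j) expMeanLogSU) j' U) c' := fun i =>
    have hj : (((constrEnum 𝔹 k).symm i).1 : ℕ) ≤ P.m + P.K := (Nat.lt_succ_iff.1 ((constrEnum 𝔹 k).symm i).1.2).trans hk
    eventually_guardOn _ hj (preimage_blockIter_saturated hj _) (hg i)
  filter_upwards [eventually_all.2 key] with Q hQ U hU i using hQ i U hU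

end Guard

/-! ## §2  The logarithmic datum coordinates under the tower guards -/

section Coordinates

variable {P : Params} (𝔹 : DetSet P) (k : ℕ) (hk : k ≤ P.m + P.K) (W : MSField P SU2)
include hk

/-- The relative holomorphic average at every constrained bond is analytic near a tower-guarded base datum on the fibre and CLOSE TO `1` there (continuity; it equals `1` on the fibre) — the twin
of `B15Prop1DatumCoordinates.eventually_norm_rel_sub_one_lt`. [cite: Balaban1987RG1, (0.4) p.253; Balaban1988Convergent, (2.11) p.256 (bookkeeping)] -/
theorem eventually_norm_rel_sub_one_lt_of_guardOn {Q₀ : GaugeField P 0 SU2}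
    (hg : ∀ i : Fin (constrCard 𝔹 k), ∀ j', j' < (((constrEnum 𝔹 k).symm i).1 : ℕ) → ∀ c' : PBond P (j' + 1),
      c' ∈ bondsIn (j' + 1) (blockIter (((constrEnum 𝔹 k).symm i).1 : ℕ) ⁻¹'
        ({((constrEnum 𝔹 k).symm i).2.1.src, ((constrEnum 𝔹 k).symm i).2.1.tgt} : Set (Site P ((constrEnum 𝔹 k).symm i).1))) →
        Small expMeanLogSU (Averaging.iter (fun j => blockAvg (P := P) (j := j) expMeanLogSU) j' Q₀) c')
    (hW : AgreeOn 𝔹 (avgFamily (fun j => blockAvg (P := P) (j := j) expMeanLogSU) Q₀) W) {r : ℝ} (hr : 0 < r) :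
    ∀ᶠ Q in 𝓝 (coeField Q₀), ∀ i : Fin (constrCard 𝔹 k),
      ‖star ((W ((constrEnum 𝔹 k).symm i).1 ((constrEnum 𝔹 k).symm i).2.1 : SU2) : Matrix (Fin 2) (Fin 2) ℂ) *
          iterMh ((constrEnum 𝔹 k).symm i).1 Q ((constrEnum 𝔹 k).symm i).2.1 - 1‖ < r := by
  refine eventually_all.2 fun i => ?_
  set s := (constrEnum 𝔹 k).symm i with hs
  have hjk : (s.1 : ℕ) ≤ k := Nat.lt_succ_iff.1 s.1.2
  have hj : (s.1 : ℕ) ≤ P.m + P.K := hjk.trans hk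
  have hit : AnalyticAt ℂ (fun Q : PBond P 0 → Matrix (Fin 2) (Fin 2) ℂ => iterMh (s.1 : ℕ) Q s.2.1) (coeField Q₀) :=
    analyticAt_iterMh_apply_of_polydiscOn _ hj (preimage_blockIter_saturated hj _)
      (fun j' hj' c' hc' i' => lt_of_lt_of_le (polydiscOn_constr_of_guardOn hj s.2.1 (hg i) (fun _ _ => rfl) j' hj' c' hc' i') deltaSU_le_one)
      _ (self_mem_bondsIn_towerRegion hj _)
  have hc : ContinuousAt (fun Q : PBond P 0 → Matrix (Fin 2) (Fin 2) ℂ =>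
      ‖star ((W s.1 s.2.1 : SU2) : Matrix (Fin 2) (Fin 2) ℂ) * iterMh s.1 Q s.2.1 - 1‖) (coeField Q₀) :=
    (((continuousAt_const.mul hit.continuousAt)).sub continuousAt_const).norm
  have h0 : ‖star ((W s.1 s.2.1 : SU2) : Matrix (Fin 2) (Fin 2) ℂ) * iterMh s.1 (coeField Q₀) s.2.1 - 1‖ < r := by
    rw [star_coe_mul_iterMh_coeField_of_guardOn W hj s.2.1 (hg i), hW _ _ s.2.2, star_coe_mul_coe_SU, sub_self, norm_zero]
    exact hr
  exact hc.eventually (Iio_mem_nhds h0)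

variable (κ : (PBond P 0 → Matrix (Fin 2) (Fin 2) ℂ) → Fin (constrCard 𝔹 k) → EuclideanSpace ℂ (Fin 3))
  (hκ : ∀ Q i, κ Q i = logCoordC (star ((W ((constrEnum 𝔹 k).symm i).1 ((constrEnum 𝔹 k).symm i).2.1 : SU2) : Matrix (Fin 2) (Fin 2) ℂ) *
    iterMh ((constrEnum 𝔹 k).symm i).1 Q ((constrEnum 𝔹 k).symm i).2.1))
include hκ

/-- ★ **ZERO ON THE FIBRE** (twin of `datumCoord_coeField_eq_zero_of_agreeOn`): at an `SU(2)` field `U` guarded along the towers of the constrained bonds whose averages agree with `W` on `𝔹`,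
every datum coordinate vanishes (`W⋆W = 1`, `log 1 = 0`). [cite: Balaban1988Convergent, (2.10)–(2.12) p.256; Balaban1985Variational, Sect. C (47) p.285] -/
theorem datumCoord_coeField_eq_zero_of_agreeOn_of_guardOn {U : GaugeField P 0 SU2}
    (hg : ∀ i : Fin (constrCard 𝔹 k), ∀ j', j' < (((constrEnum 𝔹 k).symm i).1 : ℕ) → ∀ c' : PBond P (j' + 1),
      c' ∈ bondsIn (j' + 1) (blockIter (((constrEnum 𝔹 k).symm i).1 : ℕ) ⁻¹'
        ({((constrEnum 𝔹 k).symm i).2.1.src, ((constrEnum 𝔹 k).symm i).2.1.tgt} : Set (Site P ((constrEnum 𝔹 k).symm i).1))) →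
        Small expMeanLogSU (Averaging.iter (fun j => blockAvg (P := P) (j := j) expMeanLogSU) j' U) c')
    (hU : AgreeOn 𝔹 (avgFamily (fun j => blockAvg (P := P) (j := j) expMeanLogSU) U) W) : κ (coeField U) = 0 := by
  funext i
  have hj : ((((constrEnum 𝔹 k).symm i).1 : ℕ)) ≤ P.m + P.K := (Nat.lt_succ_iff.1 ((constrEnum 𝔹 k).symm i).1.2).trans hk
  rw [hκ, star_coe_mul_iterMh_coeField_of_guardOn W hj _ (hg i), hU _ _ ((constrEnum 𝔹 k).symm i).2.2, star_coe_mul_coe_SU, logCoordC_one]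
  rfl

/-- ★★ **THE DATUM COORDINATES ARE ANALYTIC NEAR A TOWER-GUARDED BASE DATUM ON THE FIBRE** (twin of `eventually_analyticAt_datumCoord`: the iterate at each constrained bond is analytic on the
tower polydisc, which is open; the relative average stays within `1` of `1`, where `logCoordC` is analytic). [cite: Balaban1985Variational, Sect. G p.305, Prop. 9 (190) p.309; Balaban1987RG1, (0.4) p.253; Balaban1985Averaging, (21) p.21] -/
theorem eventually_analyticAt_datumCoord_of_guardOn {Q₀ : GaugeField P 0 SU2}
    (hg : ∀ i : Fin (constrCard 𝔹 k), ∀ j', j' < (((constrEnum 𝔹 k).symm i).1 : ℕ) → ∀ c' : PBond P (j' + 1),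
      c' ∈ bondsIn (j' + 1) (blockIter (((constrEnum 𝔹 k).symm i).1 : ℕ) ⁻¹'
        ({((constrEnum 𝔹 k).symm i).2.1.src, ((constrEnum 𝔹 k).symm i).2.1.tgt} : Set (Site P ((constrEnum 𝔹 k).symm i).1))) →
        Small expMeanLogSU (Averaging.iter (fun j => blockAvg (P := P) (j := j) expMeanLogSU) j' Q₀) c')
    (hW : AgreeOn 𝔹 (avgFamily (fun j => blockAvg (P := P) (j := j) expMeanLogSU) Q₀) W) :
    ∀ᶠ Q in 𝓝 (coeField Q₀), AnalyticAt ℂ κ Q := by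
  have hfun : κ = fun Q i => logCoordC (star ((W ((constrEnum 𝔹 k).symm i).1 ((constrEnum 𝔹 k).symm i).2.1 : SU2) : Matrix (Fin 2) (Fin 2) ℂ) *
      iterMh ((constrEnum 𝔹 k).symm i).1 Q ((constrEnum 𝔹 k).symm i).2.1) := funext fun Q => funext (hκ Q)
  have hpolyAll : ∀ᶠ Q in 𝓝 (coeField Q₀), ∀ i : Fin (constrCard 𝔹 k),
      ∀ j', j' < (((constrEnum 𝔹 k).symm i).1 : ℕ) → ∀ c' : PBond P (j' + 1),
        c' ∈ bondsIn (j' + 1) (blockIter (((constrEnum 𝔹 k).symm i).1 : ℕ) ⁻¹'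
          ({((constrEnum 𝔹 k).symm i).2.1.src, ((constrEnum 𝔹 k).symm i).2.1.tgt} : Set (Site P ((constrEnum 𝔹 k).symm i).1))) →
          ∀ i' : Idx P, ‖loopMh (iterMh j' Q) c' i' - 1‖ < 1 :=
    eventually_all.2 fun i =>
      eventually_polydiscOn_one_constr ((Nat.lt_succ_iff.1 ((constrEnum 𝔹 k).symm i).1.2).trans hk) _ (hg i)
  filter_upwards [hpolyAll, eventually_norm_rel_sub_one_lt_of_guardOn 𝔹 k hk W hg hW one_pos] with Q hpoly hrel
  rw [hfun]
  refine analyticAt_pi_iff.2 fun i => ?_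
  have hr := hrel i
  set s := (constrEnum 𝔹 k).symm i with hs
  have hj : (s.1 : ℕ) ≤ P.m + P.K := (Nat.lt_succ_iff.1 s.1.2).trans hk
  have hit : AnalyticAt ℂ (fun Q : PBond P 0 → Matrix (Fin 2) (Fin 2) ℂ => iterMh (s.1 : ℕ) Q s.2.1) Q :=
    analyticAt_iterMh_apply_of_polydiscOn _ hj (preimage_blockIter_saturated hj _) (hpoly i) _ (self_mem_bondsIn_towerRegion hj _)
  have hin : AnalyticAt ℂ (fun Q : PBond P 0 → Matrix (Fin 2) (Fin 2) ℂ =>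
      star ((W s.1 s.2.1 : SU2) : Matrix (Fin 2) (Fin 2) ℂ) * iterMh s.1 Q s.2.1) Q :=
    analyticAt_const.mul hit
  have hlog : AnalyticAt ℂ logCoordC (star ((W s.1 s.2.1 : SU2) : Matrix (Fin 2) (Fin 2) ℂ) * iterMh s.1 Q s.2.1) :=
    analyticAt_logCoordC hr
  exact AnalyticAt.comp (f := fun Q : PBond P 0 → Matrix (Fin 2) (Fin 2) ℂ =>
    star ((W s.1 s.2.1 : SU2) : Matrix (Fin 2) (Fin 2) ℂ) * iterMh s.1 Q s.2.1) (x := Q) hlog hin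

/-- ★★ **THE DATUM COORDINATES ARE ℂ-DIFFERENTIABLE NEAR THE BASE DATUM** under the tower guards — the hypothesis `hκd` of `exists_localChart_of_criticalFamily_local`.
[cite: Balaban1985Variational, Prop. 9 (190) p.309] -/
theorem eventually_differentiableAt_datumCoord_of_guardOn {Q₀ : GaugeField P 0 SU2}
    (hg : ∀ i : Fin (constrCard 𝔹 k), ∀ j', j' < (((constrEnum 𝔹 k).symm i).1 : ℕ) → ∀ c' : PBond P (j' + 1),
      c' ∈ bondsIn (j' + 1) (blockIter (((constrEnum 𝔹 k).symm i).1 : ℕ) ⁻¹'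
        ({((constrEnum 𝔹 k).symm i).2.1.src, ((constrEnum 𝔹 k).symm i).2.1.tgt} : Set (Site P ((constrEnum 𝔹 k).symm i).1))) →
        Small expMeanLogSU (Averaging.iter (fun j => blockAvg (P := P) (j := j) expMeanLogSU) j' Q₀) c')
    (hW : AgreeOn 𝔹 (avgFamily (fun j => blockAvg (P := P) (j := j) expMeanLogSU) Q₀) W) :
    ∀ᶠ Q in 𝓝 (coeField Q₀), DifferentiableAt ℂ κ Q := by
  filter_upwards [eventually_analyticAt_datumCoord_of_guardOn 𝔹 k hk W κ hκ hg hW] with Q hQ using hQ.differentiableAt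

/-- ★★ **THE DATUM COORDINATES ARE REAL ON `SU(2)` DATA NEAR THE BASE** under the tower guards (twin of `eventually_datumCoord_real`): for `SU(2)` configurations `Q′` with `↑Q′` near `↑Q₀`,
`Q′` is tower-guarded at every constrained bond (§1), its relative averages `W⋆·Ū(Q′)` are `SU(2)` matrices within `1∕3` of `1`, and there `logCoordC ((A⋆)⁻¹) = conj (logCoordC A)` with
`(A⋆)⁻¹ = A` — the hypothesis `hκreal`. [cite: Balaban1985Variational, p.307, (181) p.307, Prop. 9 (190) p.309; Balaban1985Averaging, (23) p.21] -/
theorem eventually_datumCoord_real_of_guardOn {Q₀ : GaugeField P 0 SU2}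
    (hg : ∀ i : Fin (constrCard 𝔹 k), ∀ j', j' < (((constrEnum 𝔹 k).symm i).1 : ℕ) → ∀ c' : PBond P (j' + 1),
      c' ∈ bondsIn (j' + 1) (blockIter (((constrEnum 𝔹 k).symm i).1 : ℕ) ⁻¹'
        ({((constrEnum 𝔹 k).symm i).2.1.src, ((constrEnum 𝔹 k).symm i).2.1.tgt} : Set (Site P ((constrEnum 𝔹 k).symm i).1))) →
        Small expMeanLogSU (Averaging.iter (fun j => blockAvg (P := P) (j := j) expMeanLogSU) j' Q₀) c')
    (hW : AgreeOn 𝔹 (avgFamily (fun j => blockAvg (P := P) (j := j) expMeanLogSU) Q₀) W)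
    (cF : (Fin (constrCard 𝔹 k) → EuclideanSpace ℂ (Fin 3)) → Fin (constrCard 𝔹 k) → EuclideanSpace ℂ (Fin 3))
    (hcF : ∀ v i a, cF v i a = conj (v i a)) :
    ∀ᶠ Q in 𝓝 (coeField Q₀), ∀ Q' : GaugeField P 0 SU2, coeField Q' = Q → cF (κ Q) = κ Q := by
  filter_upwards [eventually_guardOn_constr 𝔹 k hk hg, eventually_norm_rel_sub_one_lt_of_guardOn 𝔹 k hk W hg hW (by norm_num : (0 : ℝ) < 1 / 3)]
    with Q hguard hrel Q' hQ'
  have hg' := hguard Q' hQ'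
  subst hQ'
  funext i; ext a
  rw [hcF, hκ]
  set s := (constrEnum 𝔹 k).symm i with hs
  have hj : (s.1 : ℕ) ≤ P.m + P.K := (Nat.lt_succ_iff.1 s.1.2).trans hk
  have hA := star_coe_mul_iterMh_coeField_of_guardOn W hj s.2.1 (hg' i)
  have hr := (hrel i).le
  rw [hA] at hr ⊢
  have hθ := logCoordC_theta hr
  rw [star_inv_relMatrix] at hθ
  have ha := congrArg (fun v : EuclideanSpace ℂ (Fin 3) => v a) hθ
  simp only at ha
  exact ha.symm

/-- ★★ **THE DATUM COORDINATES INTERTWINE `θ` WITH COORDINATEWISE CONJUGATION NEAR THE BASE** under the tower guards (twin of `eventually_datumCoord_theta`): for `Q` near `↑Q₀` with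
invertible entries, `κ (θ ∘ Q) = conj ∘ κ Q` — `θ` passes the iterate AT EACH CONSTRAINED BOND on the tower `1∕3`-polydisc (`…LocalAnalytic.iterMh_theta_apply_of_polydiscOn`), `W⋆ · θ(M) = θ(W⋆ · M)`
for unitary `W`, and `logCoordC ∘ θ = conj ∘ logCoordC` within `1∕3` of `1`. [cite: Balaban1985Variational, p.307, (181) p.307, Prop. 9 (190) p.309; Balaban1985Averaging, (23) p.21] -/
theorem eventually_datumCoord_theta_of_guardOn {Q₀ : GaugeField P 0 SU2}
    (hg : ∀ i : Fin (constrCard 𝔹 k), ∀ j', j' < (((constrEnum 𝔹 k).symm i).1 : ℕ) → ∀ c' : PBond P (j' + 1),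
      c' ∈ bondsIn (j' + 1) (blockIter (((constrEnum 𝔹 k).symm i).1 : ℕ) ⁻¹'
        ({((constrEnum 𝔹 k).symm i).2.1.src, ((constrEnum 𝔹 k).symm i).2.1.tgt} : Set (Site P ((constrEnum 𝔹 k).symm i).1))) →
        Small expMeanLogSU (Averaging.iter (fun j => blockAvg (P := P) (j := j) expMeanLogSU) j' Q₀) c')
    (hW : AgreeOn 𝔹 (avgFamily (fun j => blockAvg (P := P) (j := j) expMeanLogSU) Q₀) W)
    (cF : (Fin (constrCard 𝔹 k) → EuclideanSpace ℂ (Fin 3)) → Fin (constrCard 𝔹 k) → EuclideanSpace ℂ (Fin 3))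
    (hcF : ∀ v i a, cF v i a = conj (v i a)) :
    ∀ᶠ Q in 𝓝 (coeField Q₀), (∀ b, IsUnit (Q b).det) → κ (fun b => (star (Q b))⁻¹) = cF (κ Q) := by
  -- the tower `1∕3`-polydisc at `↑Q₀` for every constrained bond, and its persistence nearby
  have h3All : ∀ᶠ Q in 𝓝 (coeField Q₀), ∀ i : Fin (constrCard 𝔹 k),
      ∀ j', j' < (((constrEnum 𝔹 k).symm i).1 : ℕ) → ∀ c' : PBond P (j' + 1),
        c' ∈ bondsIn (j' + 1) (blockIter (((constrEnum 𝔹 k).symm i).1 : ℕ) ⁻¹'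
          ({((constrEnum 𝔹 k).symm i).2.1.src, ((constrEnum 𝔹 k).symm i).2.1.tgt} : Set (Site P ((constrEnum 𝔹 k).symm i).1))) →
          ∀ i' : Idx P, ‖loopMh (iterMh j' Q) c' i' - 1‖ < 1 / 3 := by
    refine eventually_all.2 fun i => ?_
    have hj : ((((constrEnum 𝔹 k).symm i).1 : ℕ)) ≤ P.m + P.K := (Nat.lt_succ_iff.1 ((constrEnum 𝔹 k).symm i).1.2).trans hk
    exact eventually_polydiscOn _ hj (preimage_blockIter_saturated hj _) (by norm_num : (1 : ℝ) / 3 ≤ 1)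
      fun j' hj' c' hc' i' => lt_third_of_lt_deltaSU (polydiscOn_constr_of_guardOn hj _ (hg i) (fun _ _ => rfl) j' hj' c' hc' i')
  filter_upwards [h3All, eventually_norm_rel_sub_one_lt_of_guardOn 𝔹 k hk W hg hW (by norm_num : (0 : ℝ) < 1 / 3)] with Q hpoly hrel hunit
  funext i; ext a
  rw [hcF, hκ, hκ]
  have hr := (hrel i).le
  set s := (constrEnum 𝔹 k).symm i with hs
  have hj : (s.1 : ℕ) ≤ P.m + P.K := (Nat.lt_succ_iff.1 s.1.2).trans hk
  have hθ : iterMh (s.1 : ℕ) (fun b => (star (Q b))⁻¹) s.2.1 = (star (iterMh (s.1 : ℕ) Q s.2.1))⁻¹ :=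
    iterMh_theta_apply_of_polydiscOn hunit _ hj (preimage_blockIter_saturated hj _) (fun j' hj' c' hc' i' => (hpoly i j' hj' c' hc' i').le)
      _ (self_mem_bondsIn_towerRegion hj _)
  have hWinv : (((W s.1 s.2.1 : SU2) : Matrix (Fin 2) (Fin 2) ℂ))⁻¹ = star ((W s.1 s.2.1 : SU2) : Matrix (Fin 2) (Fin 2) ℂ) :=
    Matrix.inv_eq_left_inv (star_coe_mul_coe_SU _)
  have hprod : star ((W s.1 s.2.1 : SU2) : Matrix (Fin 2) (Fin 2) ℂ) * (star (iterMh (s.1 : ℕ) Q s.2.1))⁻¹ =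
      (star (star ((W s.1 s.2.1 : SU2) : Matrix (Fin 2) (Fin 2) ℂ) * iterMh (s.1 : ℕ) Q s.2.1))⁻¹ := by
    rw [B15AveragingHolomorphic.star_inv_mul_star_inv, star_star, hWinv]
  rw [hθ, hprod, logCoordC_theta hr]

end Coordinates

/-! ## §3  Injectivity on the fibre side under the tower guards -/

section Injective

variable {P : Params} (𝔹 : DetSet P) (k : ℕ) (hk : k ≤ P.m + P.K) (W : MSField P SU2)
  (κ : (PBond P 0 → Matrix (Fin 2) (Fin 2) ℂ) → Fin (constrCard 𝔹 k) → EuclideanSpace ℂ (Fin 3))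
  (hκ : ∀ Q i, κ Q i = logCoordC (star ((W ((constrEnum 𝔹 k).symm i).1 ((constrEnum 𝔹 k).symm i).2.1 : SU2) : Matrix (Fin 2) (Fin 2) ℂ) *
    iterMh ((constrEnum 𝔹 k).symm i).1 Q ((constrEnum 𝔹 k).symm i).2.1))
include hk hκ

/-- ★★ **EQUAL COORDINATES ⇒ EQUAL AVERAGES ON `𝔹`** under the tower guards (twin of `agreeOn_of_datumCoord_eq`): for a determining set of levels `≤ k`, two `SU(2)` fields guarded along the
towers of the constrained bonds, whose relative averages there lie within `1∕3` of `1` and whose datum coordinates coincide, have the same multi-scale averages on `𝔹`.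
[cite: Balaban1988Convergent, (2.10)–(2.11) p.256; Balaban1985Averaging, (21) p.21; Balaban1985Variational, Sect. C (47)–(48) p.285] -/
theorem agreeOn_of_datumCoord_eq_of_guardOn (h𝔹 : ∀ j, k < j → 𝔹 j = ∅) {U Q' : GaugeField P 0 SU2}
    (hgU : ∀ i : Fin (constrCard 𝔹 k), ∀ j', j' < (((constrEnum 𝔹 k).symm i).1 : ℕ) → ∀ c' : PBond P (j' + 1),
      c' ∈ bondsIn (j' + 1) (blockIter (((constrEnum 𝔹 k).symm i).1 : ℕ) ⁻¹'
        ({((constrEnum 𝔹 k).symm i).2.1.src, ((constrEnum 𝔹 k).symm i).2.1.tgt} : Set (Site P ((constrEnum 𝔹 k).symm i).1))) →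
        Small expMeanLogSU (Averaging.iter (fun j => blockAvg (P := P) (j := j) expMeanLogSU) j' U) c')
    (hgQ : ∀ i : Fin (constrCard 𝔹 k), ∀ j', j' < (((constrEnum 𝔹 k).symm i).1 : ℕ) → ∀ c' : PBond P (j' + 1),
      c' ∈ bondsIn (j' + 1) (blockIter (((constrEnum 𝔹 k).symm i).1 : ℕ) ⁻¹'
        ({((constrEnum 𝔹 k).symm i).2.1.src, ((constrEnum 𝔹 k).symm i).2.1.tgt} : Set (Site P ((constrEnum 𝔹 k).symm i).1))) →
        Small expMeanLogSU (Averaging.iter (fun j => blockAvg (P := P) (j := j) expMeanLogSU) j' Q') c')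
    (hrU : ∀ i : Fin (constrCard 𝔹 k), ‖star ((W ((constrEnum 𝔹 k).symm i).1 ((constrEnum 𝔹 k).symm i).2.1 : SU2) : Matrix (Fin 2) (Fin 2) ℂ) *
      iterMh ((constrEnum 𝔹 k).symm i).1 (coeField U) ((constrEnum 𝔹 k).symm i).2.1 - 1‖ ≤ 1 / 3)
    (hrQ : ∀ i : Fin (constrCard 𝔹 k), ‖star ((W ((constrEnum 𝔹 k).symm i).1 ((constrEnum 𝔹 k).symm i).2.1 : SU2) : Matrix (Fin 2) (Fin 2) ℂ) *
      iterMh ((constrEnum 𝔹 k).symm i).1 (coeField Q') ((constrEnum 𝔹 k).symm i).2.1 - 1‖ ≤ 1 / 3)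
    (heq : κ (coeField U) = κ (coeField Q')) :
    AgreeOn 𝔹 (avgFamily (fun j => blockAvg (P := P) (j := j) expMeanLogSU) U) (avgFamily (fun j => blockAvg (P := P) (j := j) expMeanLogSU) Q') := by
  intro j c hc
  by_cases hjk : k < j
  · rw [h𝔹 j hjk] at hc
    simp [bondsOf] at hc
  have hj : j ≤ k := Nat.le_of_not_lt hjk
  have hjK : j ≤ P.m + P.K := hj.trans hk
  let s₀ : ConstrSet 𝔹 k := ⟨⟨j, Nat.lt_succ_of_le hj⟩, c, hc⟩
  have hi := congrFun heq (constrEnum 𝔹 k s₀)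
  have hrU' := hrU (constrEnum 𝔹 k s₀)
  have hrQ' := hrQ (constrEnum 𝔹 k s₀)
  have hgU' := hgU (constrEnum 𝔹 k s₀)
  have hgQ' := hgQ (constrEnum 𝔹 k s₀)
  rw [hκ, hκ, Equiv.symm_apply_apply] at hi
  rw [Equiv.symm_apply_apply] at hrU' hrQ' hgU' hgQ'
  change logCoordC (star ((W j c : SU2) : Matrix (Fin 2) (Fin 2) ℂ) * iterMh j (coeField U) c) =
    logCoordC (star ((W j c : SU2) : Matrix (Fin 2) (Fin 2) ℂ) * iterMh j (coeField Q') c) at hi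
  change ‖star ((W j c : SU2) : Matrix (Fin 2) (Fin 2) ℂ) * iterMh j (coeField U) c - 1‖ ≤ 1 / 3 at hrU'
  change ‖star ((W j c : SU2) : Matrix (Fin 2) (Fin 2) ℂ) * iterMh j (coeField Q') c - 1‖ ≤ 1 / 3 at hrQ'
  change ∀ j', j' < j → ∀ c' : PBond P (j' + 1), c' ∈ bondsIn (j' + 1) (blockIter j ⁻¹' ({c.src, c.tgt} : Set (Site P j))) →
    Small expMeanLogSU (Averaging.iter (fun j => blockAvg (P := P) (j := j) expMeanLogSU) j' U) c' at hgU'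
  change ∀ j', j' < j → ∀ c' : PBond P (j' + 1), c' ∈ bondsIn (j' + 1) (blockIter j ⁻¹' ({c.src, c.tgt} : Set (Site P j))) →
    Small expMeanLogSU (Averaging.iter (fun j => blockAvg (P := P) (j := j) expMeanLogSU) j' Q') c' at hgQ'
  rw [star_coe_mul_iterMh_coeField_of_guardOn W hjK c hgU'] at hi hrU'
  rw [star_coe_mul_iterMh_coeField_of_guardOn W hjK c hgQ'] at hi hrQ'
  have hmat : star ((W j c : SU2) : Matrix (Fin 2) (Fin 2) ℂ) * ((avgFamily (fun j => blockAvg (P := P) (j := j) expMeanLogSU) U j c : SU2) : Matrix (Fin 2) (Fin 2) ℂ) =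
      star ((W j c : SU2) : Matrix (Fin 2) (Fin 2) ℂ) * ((avgFamily (fun j => blockAvg (P := P) (j := j) expMeanLogSU) Q' j c : SU2) : Matrix (Fin 2) (Fin 2) ℂ) := by
    rw [← expPointC_logCoordC hrU' (det_relMatrix _ _), ← expPointC_logCoordC hrQ' (det_relMatrix _ _), hi]
  have hcancel := congrArg (fun M => ((W j c : SU2) : Matrix (Fin 2) (Fin 2) ℂ) * M) hmat
  simp only [← mul_assoc, coe_mul_star_coe_SU, one_mul] at hcancel
  exact Subtype.ext hcancel

/-- ★ **THE FIBRE TRANSFER NEAR A PAIR OF BASE FIELDS** under the tower guards (twin of `eventually_agreeOn_of_datumCoord_eq`): near `(↑U₀, ↑Q₀)`, with `U₀`, `Q₀` guarded along the towers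
of the constrained bonds and both on the fibre of `W`, any two `SU(2)` fields with those matrix fields and EQUAL datum coordinates have equal averages on `𝔹` — the fibre clause of `htransfer`.
[cite: Balaban1988Convergent, (2.10)–(2.12) p.256; Balaban1985Variational, Sect. C (47)–(48) p.285, Prop. 9 p.309] -/
theorem eventually_agreeOn_of_datumCoord_eq_of_guardOn (h𝔹 : ∀ j, k < j → 𝔹 j = ∅) {U₀ Q₀ : GaugeField P 0 SU2}
    (hgU : ∀ i : Fin (constrCard 𝔹 k), ∀ j', j' < (((constrEnum 𝔹 k).symm i).1 : ℕ) → ∀ c' : PBond P (j' + 1),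
      c' ∈ bondsIn (j' + 1) (blockIter (((constrEnum 𝔹 k).symm i).1 : ℕ) ⁻¹'
        ({((constrEnum 𝔹 k).symm i).2.1.src, ((constrEnum 𝔹 k).symm i).2.1.tgt} : Set (Site P ((constrEnum 𝔹 k).symm i).1))) →
        Small expMeanLogSU (Averaging.iter (fun j => blockAvg (P := P) (j := j) expMeanLogSU) j' U₀) c')
    (hgQ : ∀ i : Fin (constrCard 𝔹 k), ∀ j', j' < (((constrEnum 𝔹 k).symm i).1 : ℕ) → ∀ c' : PBond P (j' + 1),
      c' ∈ bondsIn (j' + 1) (blockIter (((constrEnum 𝔹 k).symm i).1 : ℕ) ⁻¹'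
        ({((constrEnum 𝔹 k).symm i).2.1.src, ((constrEnum 𝔹 k).symm i).2.1.tgt} : Set (Site P ((constrEnum 𝔹 k).symm i).1))) →
        Small expMeanLogSU (Averaging.iter (fun j => blockAvg (P := P) (j := j) expMeanLogSU) j' Q₀) c')
    (hU : AgreeOn 𝔹 (avgFamily (fun j => blockAvg (P := P) (j := j) expMeanLogSU) U₀) W)
    (hQ : AgreeOn 𝔹 (avgFamily (fun j => blockAvg (P := P) (j := j) expMeanLogSU) Q₀) W) :
    ∀ᶠ w in 𝓝 (coeField U₀, coeField Q₀), ∀ U' Q' : GaugeField P 0 SU2, coeField U' = w.1 → coeField Q' = w.2 → κ w.1 = κ w.2 →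
      AgreeOn 𝔹 (avgFamily (fun j => blockAvg (P := P) (j := j) expMeanLogSU) U') (avgFamily (fun j => blockAvg (P := P) (j := j) expMeanLogSU) Q') := by
  have h3 : (0 : ℝ) < 1 / 3 := by norm_num
  have hU' := (eventually_guardOn_constr 𝔹 k hk hgU).and (eventually_norm_rel_sub_one_lt_of_guardOn 𝔹 k hk W hgU hU h3)
  have hQ' := (eventually_guardOn_constr 𝔹 k hk hgQ).and (eventually_norm_rel_sub_one_lt_of_guardOn 𝔹 k hk W hgQ hQ h3)
  filter_upwards [hU'.prod_nhds hQ'] with w hw U' Q' hU'w hQ'w heq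
  obtain ⟨⟨hgU', hrU⟩, ⟨hgQ', hrQ⟩⟩ := hw
  refine agreeOn_of_datumCoord_eq_of_guardOn 𝔹 k hk W κ hκ h𝔹 (hgU' U' hU'w) (hgQ' Q' hQ'w) (fun i => ?_) (fun i => ?_) (by rw [hU'w, hQ'w]; exact heq)
  · rw [hU'w]; exact (hrU i).le
  · rw [hQ'w]; exact (hrQ i).le

end Injective

end Literature.MathematicalPhysics.QuantumFieldTheory.Balaban1983to89.B15Prop1DatumCoordinatesTower

end
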